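import Summits.HodgeConjecture.HodgeConjecture.Theses.HeckePrymWeil
import Summits.HodgeConjecture.HodgeConjecture.Theorems.HeckePrymWeilWeilSixfoldsSqrtMinus7OfSemiregularCleanLci
import HarnessLib.Audit

/-!
# Line `semiregular-clean-lci-six` — skeleton r1 (lead c12) for crux `HeckePrymWeil.WeilSixfoldsSqrtMinus7`
(item stmt-HodgeConjecture-1260, route route-HodgeConjecture-HeckePrymWeil).  r0 = the crux-strategist's
`planner-cstrat-stmt-HodgeConjecture-1260-s1-0` skeleton (sha 701ffe1f, 2026-08-17 02:17Z).  r1 (lead c12, 2026-08-17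
03:1xZ): SAME three open stubs, same composition idea; the ~500 lines of glue of r0 are now a LANDED theorem of the tree,
`Theorems/HeckePrymWeilWeilSixfoldsSqrtMinus7OfSemiregularCleanLci.lean`
(`weilSixfoldsSqrtMinus7_of_semiregularCleanLci : DeligneWeilFamily → S⁺(7,3) → BlochSemiregularSpread 6 3 →
WeilSixfoldsSqrtMinus7`, p140104, itself the `(7,3)` instance of the sibling lead's general
`hodgeWeil_of_semiregularCleanLci_of_globalAction`), so the skeleton is the three stubs and one line.

Stubs: `stub_deligneWeilFamily` (= route decl `DeligneWeilFamily` BY NAME, item 16866, TRUE/XL, open),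
`stub_semiregularCleanLciSix` (hardest, open — the lead's dossier `Lines/semiregular-clean-lci-six.c12.md` in the
crux dir: its sub-torus design H1 is EMPTY by the isotropy bound `…SubtorusDesignBound.lean`, p139827; integral
candidates must be non-abelian 3-folds with `h¹(N_Z) ≤ 225`), `stub_blochSemiregularSpread` (named fact
`BlochSemiregularSpread 6 3`, TRUE in print, unformalised).  Composition `WeilSixfoldsSqrtMinus7_of_stubs` concludes the
crux BY NAME.
-/

noncomputable section

set_option linter.dupNamespace false

open CategoryTheory AlgebraicGeometry Limits
open Literature.AlgebraicGeometry Literature.AlgebraicGeometry.Motives Literature.AlgebraicGeometry.HodgeTheory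

namespace Summit.HodgeConjecture.HodgeConjecture.Cruxes.WeilSixfoldsSqrtMinus7.SemiregularCleanLciSix

/-! ### The three registered stubs -/

/-- **Stub 1 — REACH = DELIGNE'S WEIL FAMILY THROUGH `X`, the route item stmt-HodgeConjecture-16866 BY NAME.**
For `p ≡ 3 (4)` prime `≥ 7`, `k ≥ 1`, a `√-p`-abelian `2k`-fold `(X, Φ)` and a non-zero rational `(k,k)`
class `c` of its strong Weil plane: a smooth projective family `f : 𝒳 → S` of relative dimension `2k`,
closed in `ℙᴺ × S`, over a smooth irreducible quasi-projective base, a global endomorphism `g` (the `√-p`),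
a chart `e : X ≅ 𝒳_{s₁}` intertwining `Φ` and `g`, abelian charts at every fibre, a GLOBAL class `W` with
`W|_{𝒳_{s₁}} = e^{-1 *} c`, and a tensor-type fibre `Y ≅ 𝒳_{s₀}` (isogeny pair with `(A₁ × A₁,
(x, y) ↦ (-p·y, x))`, `dim A₁ = k`; in Deligne's proof the diagonal CM point of the component).  TRUE
(Deligne, LNM 900, proof of Thm 4.8); Lean-XL; carried by its own item (M3 `deligne1982_weilFamily_levelStructure`
is fact-claimed) — used here only at `(p, k) = (7, 3)`, the dimension of THIS crux (no ladder, no descent).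
[cite: Deligne1982HodgeCycles, proof of Thm. 4.8 (pp. 47–52), clauses (b), (c)]
[cite: vanGeemen1994HodgeAV, §5.3–5.11] -/
theorem stub_deligneWeilFamily :
    Summit.HodgeConjecture.HodgeConjecture.Theses.HeckePrymWeil.DeligneWeilFamily := by
  sorry

/-- **Stub 2 (NEW, hardest; open) — A CLEAN, CHARGED, BLOCH-SEMIREGULAR INTEGRAL LCI 3-FOLD ON THE TENSOR/CM
ANCHOR SIXFOLD.**  Let `(Y, Ψ)` be a complex abelian sixfold with `Ψ ≫ Ψ = -7` of TENSOR TYPE — it admits an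
isogeny pair `f₁ : Y → A₁ × A₁`, `g₁ : A₁ × A₁ → Y`, `f₁ ≫ g₁ = m`, `f₁` flat, with `g₁` intertwining
`Ψ` and `(x, y) ↦ (-7y, x)`, for SOME abelian threefold `A₁` (the anchor fibre of Deligne's family; off the
split component `A₁` necessarily has `End ⊋ ℤ` — a principally polarized `A₁ ⊗ 𝒪_K` is hyperbolic,
CensusIdeateR1K3 "normalization" — and in Deligne's construction `A₁ = E_K³`, `E_K = ℂ/ℤ[(1+√-7)/2]`) — let
`e : Y ↪ ℙᴺ` be a projective embedding whose hyperplane class `h = e^*a` (`a ∈ H²(ℙᴺ)` rational,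
non-zero) is `K`-SYMMETRIC, `Ψ^* h = 7 h` — i.e. `±` a `K`-compatible polarization, the class that survives on
the generic Weil fibre (supplied in the composition by the Segre–Veronese symmetrisation `7h₀ + Ψ^*h₀` of
the family's hyperplane class) — and `x₀` a NON-ZERO rational `(3,3)` class of the strong Weil plane
`weilClassesOf Y Ψ 3 7`.  Then there are an INTEGRAL closed subscheme `i : Z ↪ Y`, a local complete
intersection of codimension 3 (regular immersion; every point of `Z` of codimension `≥ 3` in `Y`), which is
SEMIREGULAR in the sense of Bloch (`IsBlochSemiregular i 6 3`: Bloch's `π : H¹(Z, 𝒩) → H⁴(Y, Ω²)`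
injective; the target has dimension `C(6,2)·C(6,4) = 225`), a rational ambient class `θ ∈ H⁶(ℙᴺ(ℂ); ℂ)` and
`α ∈ ℚ`, `α ≠ 0`, such that the CLEAN CHARGED class `α • x₀ + e^*θ` is supported on `Z` (i.e. it spans the
class line `ℂ·cl(Z)`: `cl(Z) ∈ ℚ^× x₀ + ℚ h³`).
WHY IT MIGHT HOLD: `x₀` IS algebraic on `Y` (Künneth components of `Δ_{A₁}` across the isogeny —
`owf_anchorAlgebraic`, landed; cross-link `stub2_class_mem_algebraicClasses` below), so this is Bloch's problem
(7.5) "semiregular representatives of a KNOWN algebraic class" for ONE class on ONE variety type; the Hodge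
locus of `α x₀ + β h³` (`β ≠ 0`) in the Kuranishi space of `Y` is the smooth 9-dimensional polarized Weil
germ (a `U(3,3)`-orbit), so Bloch's necessary condition (Hodge locus smooth = image of the unobstructed
embedded deformations) HOLDS — unlike the Fermat anchors of the refuted crux `SemiregularSeedsOnAnchors`
(13941, `T²` kill); semiregularity is CHEAP to decide in dimension 6 (for an abelian sub-3-fold of an abelian
6-fold Bloch's dual map `∧⁴V^* ⊗ ∧²V̄^* → (V/V_Z)^* ⊗ ∧³V_Z^* ⊗ ∧²V̄_Z^*` is onto, so sub-tori and disjoint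
unions of `≤ 25` generic translates of them are semiregular: one `225 × 9T` rank computation); at the CM anchor
`NS ≅ Herm₆(𝒪_K)` (rank 36) and every Hodge class is a polynomial in divisors, so clean charged CLASSES abound
(strategist census §3).  WHY IT MIGHT FAIL (census §6, proved by hand this session): (i) every abelian
sub-3-fold of the CM anchor is UNCLEAN off the split component (norm obstruction: `deg pr₂|_Z / deg pr₁|_Z ∈
Nm(K^×)` while cleanliness w.r.t. `θ = aθ₁ + dθ₂` needs `(a/d)³ ∉ Nm(K^×)`); (ii) no complete intersection of
three divisors in `ℚθ₁ + ℚθ₂ + ℚN` (`N` one cross divisor) is clean and charged; (iii) disjoint unions of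
translated graph 3-tori indexed by a finite GROUP `G ⊂ GL₃(𝒪_K)` are clean only with zero charge
(`Σ det = 0`) or on the split component (`det ≡ 1`); by the Voisin–Lübke barrier (census K2 B6) the
`h³`-coefficient of `cl(Z)` must be non-zero.  Surviving candidate shapes: non-group disjoint-graph designs
`G_i = C + u_i v_iᵀ` (`9 ≤ T ≤ 25`, an explicit overdetermined system over `K`, kit-decidable at bounded height),
determinantal / degeneracy 3-folds, zero loci of regular sections of ample rank-3 bundles with clean `c₃`, and
complete intersections of three general ample classes in the 36-dimensional Néron–Severi space (cleanliness =
polynomial identities among `3 × 3` minors of hermitian matrices).  NOT implied by the crux; implies it only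
through Stub 3 (a theorem).  [informal size L/XL; open — Bloch 1972 Remark (7.5)]
[cite: Bloch1972Semiregularity, §1, Thm. (7.3), Remark (7.5)] [cite: BuchweitzFlenner2003, (8.1), Prop. 8.2]
[cite: Deligne1982HodgeCycles, Lemma 4.5 and proof of Thm. 4.8] [cite: vanGeemen1994HodgeAV, Thm. 6.12] -/
theorem stub_semiregularCleanLciSix :
    ∀ (Y : AbelianVariety ℂ) (Ψ : Y ⟶ Y), Y.dim = 2 * 3 → Ψ ≫ Ψ = -((7 : ℤ) • 𝟙 Y) →
      (∃ (A₁ : AbelianVariety ℂ) (f₁ : Y ⟶ A₁.prod A₁) (g₁ : A₁.prod A₁ ⟶ Y) (m : ℕ),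
          A₁.dim = 3 ∧ 0 < m ∧ f₁ ≫ g₁ = m • 𝟙 Y ∧ Flat f₁.hom.hom.hom.left ∧
          g₁ ≫ Ψ = AbelianVariety.prodLift (AbelianVariety.snd A₁ A₁ ≫ (-((7 : ℤ) • 𝟙 A₁)))
            (AbelianVariety.fst A₁ A₁) ≫ g₁) →
      ∀ (e : ProjectiveEmbedding Y.X) (a : complexBetti (projectiveSpace e.n ℂ) 2),
        IsRationalClass a → a ≠ 0 →
        -- the hyperplane class `h = e^* a` is `K`-SYMMETRIC: `Ψ^* h = 7 h` (a `K`-compatible polarization)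
        complexBetti.map Ψ.hom.hom.hom 2 (complexBetti.map e.ι 2 a) = (7 : ℂ) • complexBetti.map e.ι 2 a →
      ∀ (x₀ : complexBetti Y.X (2 * 3)),
        x₀ ∈ weilClassesOf Y Ψ 3 7 → x₀ ≠ 0 → IsRationalClass x₀ →
        IsOfHodgeType (2 * 3) Y.X (2 * 3) 3 3 x₀ →
        ∃ (Z : Scheme.{0}) (i : Z ⟶ Y.X.left) (θ : complexBetti (projectiveSpace e.n ℂ) (2 * 3)) (α : ℚ),
          IsClosedImmersion i ∧ IsRegularImmersionOfCodim i 3 ∧ AlgebraicGeometry.IsIntegral Z ∧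
          (∀ z ∈ Set.range i.base, ((3 : ℕ) : ℕ∞) ≤ Order.coheight z) ∧
          IsBlochSemiregular i 6 3 ∧ IsRationalClass θ ∧ α ≠ 0 ∧
          ((α : ℂ) • x₀ + complexBetti.map e.ι (2 * 3) θ) ∈
            classesSupportedOn Y.X (Set.range i.base) (2 * 3) := by
  sorry

/-- **Stub 3 — BLOCH'S SEMIREGULARITY THEOREM, class-level, at `(n, p) = (6, 3)`** (named fact
`HodgeTheory.BlochSemiregularSpread`: Bloch 1972 Thm (7.4) with Remark (7.5) = Buchweitz–Flenner 2003
Thm 5.2 at `I = {p}`; Voisin, Torino Lecture 7, Thm 2.4): along a smooth projective family over a smooth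
quasi-projective base, a global class fibrewise rational of type `(3,3)` whose restriction to the marked
fibre is supported on an integral Bloch-semiregular lci of codimension 3 is ALGEBRAIC on a neighbourhood of
the marked point.  TRUE in print; Lean-L (Bloch's (6.10)/(7.1) over Artin bases, Hilbert scheme, Artin
approximation; the tree has the real carrier `IsBlochSemiregular` and the obstruction bridge files; the cells
`p = 0`, `p ≥ n`, `p = 1`, `n ≤ 3` are proved in `BlochSemiregularSpreadCells`, `(6, 3)` is the first open cell
of this sector).  THE ENGINE of the line. [cite: BuchweitzFlenner2003, Thm. 5.2, (8.1), Prop. 8.2]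
[cite: Bloch1972Semiregularity, Thm. (7.1), Thm. (7.4), Remark (7.5)] [cite: VoisinTorino1994, Lecture 7, Thm. 2.3–2.4] -/
theorem stub_blochSemiregularSpread : BlochSemiregularSpread 6 3 := by
  sorry

/-! ### The composition (concludes the crux BY NAME; the glue is the landed reduction theorem) -/

/-- **`WeilSixfoldsSqrtMinus7` from the three stubs** — the skeleton theorem (concludes the crux BY NAME;
depends on the stubs' `sorry`s and on nothing else): the landed reduction
`weilSixfoldsSqrtMinus7_of_semiregularCleanLci` (p140104) applied to the three stubs.
[cite: Bloch1972Semiregularity, Thm. (7.4), Remark (7.5)] [cite: Deligne1982HodgeCycles, proof of Thm. 4.8] -/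
theorem WeilSixfoldsSqrtMinus7_of_stubs :
    Summit.HodgeConjecture.HodgeConjecture.Theses.HeckePrymWeil.WeilSixfoldsSqrtMinus7 :=
  Summit.HodgeConjecture.HodgeConjecture.Theorems.HeckePrymWeilLine.SemiregularCleanLciSix.weilSixfoldsSqrtMinus7_of_semiregularCleanLci
    stub_deligneWeilFamily stub_semiregularCleanLciSix stub_blochSemiregularSpread

end Summit.HodgeConjecture.HodgeConjecture.Cruxes.WeilSixfoldsSqrtMinus7.SemiregularCleanLciSix

end
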